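import Summits.AtomisticToContinuum.BoseEinsteinCondensation.Theorems.BECSwapNoCatastropheAbsTorusDefs
import Literature.MathematicalPhysics.QuantumManyBody.PeriodicWeightedMaxFormGroundStates
import HarnessLib

/-!
# Route BECSwapNoCatastrophe, crux `TorusHalfSwapOverlap` — stub D: the symmetry-free transport dictionary

Route `BECSwapNoCatastrophe` (sub-problem `BoseEinsteinCondensation`), crux `TorusHalfSwapOverlap`
(stmt-AtomisticToContinuum-14393), line `registered` (skeleton v7 = truncation split), stub
`stub_absTransportDict` (D).

For a plain (not Bose-symmetrised) `C¹`, `Lℤ³`-periodic `N`-body function `Ψ : Config N → ℂ` and `L > 0`, the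
SCALED torus class

  `η_Ψ = L^{3N/2} • [Ψ ∘ fromUnitTorusN L] ∈ L²((ℝ/ℤ)^{3N})`   (Haar probability measure),

`L^{3N/2} = cellScale N L`, satisfies the dictionary used by the compactness and `L¹`-bound halves of Simon's
monotone convergence theorem on the absolute class:

* a.e. `η_Ψ t = L^{3N/2} Ψ(fromUnitTorusN L t)` (`coeFn_absTorusLp`);
* `‖η_Ψ‖² = ∫_{[0,L)^{3N}} |Ψ|²` (`ofReal_norm_absTorusLp_sq`);
* `maxFormKin L η_Ψ = ∫_{[0,L)^{3N}} |∇Ψ|²` (`maxFormKin_absTorusLp`, the momentum representation of the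
  kinetic energy, [LSSY2005, App. A (A.10)] via `tsum_sq_mul_sq_configFourierCoeff`);
* `maxFormPotW W L η_Ψ = ∫_{[0,L)^{3N}} W |Ψ|²` for every measurable weight `W` (`maxFormPotW_absTorusLp`).

This is the symmetric dictionary of `PeriodicFormCoreTrigPoly.lean` (`coeFn_formEmbed_graphEmbed`, …,
`lintegral_pot_formEmbed_graphEmbed`) with the Bose-symmetric core replaced by plain `C¹` periodic functions;
all ingredients are the symmetry-free transport lemmas of `PeriodicConfigFourier.lean`.

## References
* [LSSY2005] Lieb–Seiringer–Solovej–Yngvason, *The Mathematics of the Bose Gas and its Condensation* (2005),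
  App. A, (A.10).
* [Simon1979Forms] B. Simon, *Maximal and minimal Schrödinger forms*, J. Operator Theory 1 (1979) 37–47.
-/

noncomputable section

namespace Summit.AtomisticToContinuum.BoseEinsteinCondensation.Cruxes.TorusHalfSwapOverlap.TruncationSplit

open MeasureTheory Filter Topology
open scoped ENNReal NNReal InnerProductSpace ComplexConjugate
open Literature.MathematicalPhysics.QuantumManyBody.BoseGas
open Summit.AtomisticToContinuum.BoseEinsteinCondensation.AbsTorus

-- The measure on `ℝ/ℤ` is the Haar PROBABILITY measure, as in `PeriodicFormDomain.lean`.
attribute [local instance] formDomain_measureSpace formDomain_isProbabilityMeasure formDomain_isProbabilityMeasure_pi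

/-- Local notation for the Hilbert space `H = L²((ℝ/ℤ)^{3N})`. -/
local notation "L2T " N':max => Lp ℂ 2 (volume : Measure (UnitAddTorus (Fin N' × Fin 3)))

variable {N : ℕ} {L : ℝ}

/-! ### Scale bookkeeping -/

/-- `L^{3N} · L^{-3N} = 1` in `ℝ≥0∞`: `ofReal ((L^{3N/2})²) * ((ofReal L)³)⁻¹)^N = 1`. [folklore] -/
theorem ofReal_cellScale_sq_mul_inv_pow (hL : 0 < L) :
    ENNReal.ofReal (cellScale N L ^ 2) * ((ENNReal.ofReal L ^ 3)⁻¹) ^ N = 1 := by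
  rw [cellScale_sq hL.le, ← ofReal_inv_pow_three_pow hL N, ← ENNReal.ofReal_mul (by positivity),
    ← mul_pow, mul_inv_cancel₀ (pow_ne_zero 3 hL.ne'), one_pow, ENNReal.ofReal_one]

/-- `‖L^{3N/2} z‖₊² = ofReal (L^{3N}) ‖z‖₊²` in `ℝ≥0∞`. [folklore] -/
theorem coe_nnnorm_cellScale_mul_sq (N : ℕ) (L : ℝ) (z : ℂ) :
    ((‖(cellScale N L : ℂ) * z‖₊ : ℝ≥0∞)) ^ 2 = ENNReal.ofReal (cellScale N L ^ 2) * (‖z‖₊ : ℝ≥0∞) ^ 2 := by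
  rw [coe_nnnorm_sq_eq_ofReal, coe_nnnorm_sq_eq_ofReal, norm_mul, Complex.norm_real,
    Real.norm_of_nonneg (cellScale_nonneg N L), mul_pow, ENNReal.ofReal_mul (sq_nonneg _)]

/-! ### The dictionary for the scaled torus class of a plain `C¹` periodic function -/

section Dictionary

variable (hL : 0 < L) {Ψ : Config N → ℂ}

/-- The scaled torus class as a function on the torus: a.e. `η_Ψ t = L^{3N/2} Ψ(fromUnitTorusN L t)`.
[folklore] -/
theorem coeFn_absTorusLp (hΨ : Continuous Ψ) :
    ∀ᵐ t ∂(volume : Measure (UnitAddTorus (Fin N × Fin 3))),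
      (((cellScale N L : ℂ) • (memLp_torusFunN hL hΨ).toLp (torusFunN L Ψ) : L2T N) :
        UnitAddTorus (Fin N × Fin 3) → ℂ) t = (cellScale N L : ℂ) * Ψ (fromUnitTorusN L t) := by
  have h := (Lp.coeFn_smul ((cellScale N L : ℝ) : ℂ) ((memLp_torusFunN hL hΨ).toLp (torusFunN L Ψ))).and
    (memLp_torusFunN hL hΨ).coeFn_toLp
  filter_upwards [h] with t ht
  rw [ht.1, Pi.smul_apply, ht.2]
  simp only [torusFunN, smul_eq_mul]

/-- **Potential energy of the scaled torus class** against a measurable weight transported to the torus: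
`maxFormPotW W L η_Ψ = ∫ (W ∘ fromUnitTorusN L) |η_Ψ|² = ∫_{[0,L)^{3N}} W |Ψ|²`. [folklore] -/
theorem maxFormPotW_absTorusLp (hΨ : Continuous Ψ) {W : Config N → ℝ≥0∞} (hW : Measurable W) :
    maxFormPotW W L ((cellScale N L : ℂ) • (memLp_torusFunN hL hΨ).toLp (torusFunN L Ψ) : L2T N) =
      ∫⁻ X in cellN N L, W X * (‖Ψ X‖₊ : ℝ≥0∞) ^ 2 := by
  have hG : Measurable fun X : Config N => W X * (‖Ψ X‖₊ : ℝ≥0∞) ^ 2 :=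
    hW.mul ((hΨ.measurable.nnnorm.coe_nnreal_ennreal).pow_const 2)
  unfold maxFormPotW
  calc _ = ∫⁻ t, ENNReal.ofReal (cellScale N L ^ 2) *
        (W (fromUnitTorusN L t) * (‖Ψ (fromUnitTorusN L t)‖₊ : ℝ≥0∞) ^ 2) := by
        refine lintegral_congr_ae ((coeFn_absTorusLp hL hΨ).mono fun t ht => ?_)
        dsimp only
        rw [ht, coe_nnnorm_cellScale_mul_sq]
        ring
    _ = ENNReal.ofReal (cellScale N L ^ 2) * (((ENNReal.ofReal L ^ 3)⁻¹) ^ N *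
          ∫⁻ X in cellN N L, W X * (‖Ψ X‖₊ : ℝ≥0∞) ^ 2) := by
        rw [lintegral_const_mul' _ _ ENNReal.ofReal_ne_top, lintegral_fromUnitTorusN hL hG]
    _ = _ := by rw [← mul_assoc, ofReal_cellScale_sq_mul_inv_pow hL, one_mul]

/-- **The scaled torus class has the cell norm**: `‖η_Ψ‖² = ∫_{[0,L)^{3N}} |Ψ|²` (as an identity in
`ℝ≥0∞`; the right-hand side is finite for continuous `Ψ`). [folklore] -/
theorem ofReal_norm_absTorusLp_sq (hΨ : Continuous Ψ) :
    ENNReal.ofReal (‖((cellScale N L : ℂ) • (memLp_torusFunN hL hΨ).toLp (torusFunN L Ψ) : L2T N)‖ ^ 2) =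
      ∫⁻ X in cellN N L, (‖Ψ X‖₊ : ℝ≥0∞) ^ 2 := by
  have h := norm_Lp_two_sq_eq_toReal ((cellScale N L : ℂ) • (memLp_torusFunN hL hΨ).toLp (torusFunN L Ψ) : L2T N)
  rw [h.1, ENNReal.ofReal_toReal h.2]
  have hpot := maxFormPotW_absTorusLp hL hΨ (W := fun _ => 1) measurable_const
  unfold maxFormPotW at hpot
  simpa only [one_mul] using hpot

/-- **The spectral kinetic energy of the scaled torus class is the kinetic energy**:
`maxFormKin L η_Ψ = ∑ₙ (2πn/L)² |⟪eₙ, η_Ψ⟫|² = ∫_{[0,L)^{3N}} |∇Ψ|²` for `C¹` periodic `Ψ`.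
[cite: LSSY2005, App. A (A.10)] -/
theorem maxFormKin_absTorusLp (hΨ : ContDiff ℝ 1 Ψ) (hper : IsTorusPeriodic L Ψ) :
    maxFormKin L ((cellScale N L : ℂ) • (memLp_torusFunN hL hΨ.continuous).toLp (torusFunN L Ψ) : L2T N) =
      ∫⁻ X in cellN N L, kineticDensity Ψ X := by
  rw [maxFormKin_smul, Complex.norm_real, Real.norm_of_nonneg (cellScale_nonneg N L)]
  have hkin : maxFormKin L ((memLp_torusFunN hL hΨ.continuous).toLp (torusFunN L Ψ) : L2T N) =
      ((ENNReal.ofReal L ^ 3)⁻¹) ^ N * ∫⁻ X in cellN N L, kineticDensity Ψ X := by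
    unfold maxFormKin
    simp only [inner_mFourierLp_toLp hL hΨ.continuous]
    exact tsum_sq_mul_sq_configFourierCoeff hL hΨ hper
  rw [hkin, ← mul_assoc, ofReal_cellScale_sq_mul_inv_pow hL, one_mul]

end Dictionary

/-! ### The registered stub -/

/-- **Stub D (M): the transport dictionary for plain `C¹` periodic functions.** For `L > 0` and a `C¹`,
`Lℤ³`-periodic `Ψ : Config N → ℂ`, the scaled torus class `η_Ψ = L^{3N/2} [Ψ ∘ fromUnitTorusN L] ∈ L²((ℝ/ℤ)^{3N})`
is a.e. `L^{3N/2} Ψ ∘ fromUnitTorusN L`, has the cell norm `∫_{[0,L)^{3N}} |Ψ|²`, spectral kinetic energy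
`∫_{[0,L)^{3N}} |∇Ψ|²` and maximal-form potential energy `∫_{[0,L)^{3N}} W|Ψ|²` for every measurable weight `W`.
[cite: LSSY2005, App. A (A.10)] -/
theorem stub_absTransportDict :
    ∀ (N : ℕ) (L : ℝ), 0 < L → ∀ Ψ : Config N → ℂ, ContDiff ℝ 1 Ψ → IsTorusPeriodic L Ψ →
      ∃ ηΨ : Lp ℂ 2 (volume : Measure (UnitAddTorus (Fin N × Fin 3))),
        (∀ᵐ t ∂(volume : Measure (UnitAddTorus (Fin N × Fin 3))),
          (ηΨ : UnitAddTorus (Fin N × Fin 3) → ℂ) t = (cellScale N L : ℂ) * Ψ (fromUnitTorusN L t)) ∧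
        ENNReal.ofReal (‖ηΨ‖ ^ 2) = ∫⁻ X in cellN N L, (‖Ψ X‖₊ : ℝ≥0∞) ^ 2 ∧
        maxFormKin L ηΨ = ∫⁻ X in cellN N L, kineticDensity Ψ X ∧
        ∀ W : Config N → ℝ≥0∞, Measurable W →
          maxFormPotW W L ηΨ = ∫⁻ X in cellN N L, W X * (‖Ψ X‖₊ : ℝ≥0∞) ^ 2 := by
  intro N L hL Ψ hΨ hper
  exact ⟨(cellScale N L : ℂ) • (memLp_torusFunN hL hΨ.continuous).toLp (torusFunN L Ψ),
    coeFn_absTorusLp hL hΨ.continuous, ofReal_norm_absTorusLp_sq hL hΨ.continuous,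
    maxFormKin_absTorusLp hL hΨ hper, fun _ hW => maxFormPotW_absTorusLp hL hΨ.continuous hW⟩

end Summit.AtomisticToContinuum.BoseEinsteinCondensation.Cruxes.TorusHalfSwapOverlap.TruncationSplit
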